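import Summits.RiemannHypothesis.RiemannHypothesis.Theorems.SuzukiCleanRadiusDefs
import Summits.RiemannHypothesis.RiemannHypothesis.Theorems.SuzukiCleanRadius

/-!
# SuzukiCleanRadius — leaf: the banked RH-FREE targets `HeightOptimisedBound`, `LinearCleanRadius`, `EventuallyCleanEachWindow` HOLD (column DBR)

RH-FREE throughout; nothing here bears on the truth of RH.  This module only assembles: the typed statements of
`Theorems.SuzukiCleanRadiusDefs` (the cell rh-dbr's banked targets of the idea card `theta-semigroup-clean-radius`,
ENGINE-TARGETS.md §4.4) are discharged by the explicit theorems of `Theorems.SuzukiCleanRadius`: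
* `heightOptimisedBound_holds : HeightOptimisedBound` (from `exists_abs_limKernel_le_height`, `C = ½`, valid from `θ ≥ 2`);
* `linearCleanRadius_holds : LinearCleanRadius` (= `exists_linear_clean_radius`);
* `eventuallyCleanEachWindow_holds : EventuallyCleanEachWindow` (pure logic from the previous line).
Source of the objects: M. Suzuki, ASPM 84 (2020) 399–411 = arXiv:1907.07302, (1.9) and Thm 1.2 (K-v) (`K_θ`, its
windows; (K-v) printed with an inexplicit `τ_θ`).  Labels: RH-FREE; a clean window certifies nothing about RH.
-/

noncomputable section

-- D-0017: `Summit.<S>.<S>.…` is the designed namespace of a single-problem summit.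
set_option linter.dupNamespace false

namespace Summit.RiemannHypothesis.RiemannHypothesis.Theorems.SuzukiCleanRadius

open Literature.NumberTheory.LFunctions

/-- **`HeightOptimisedBound` HOLDS** (RH-FREE): there are absolute constants `C > 0`, `A` with
`|K_θ(x)| ≤ C e^{bx + Aθ} b^{1−θ}` for all `θ ≥ 3`, `b ≥ 3/2`, `x ∈ ℝ` (here `C = ½`; the explicit theorem
`abs_limKernel_le_height` is valid from `θ ≥ 2`). -/
theorem heightOptimisedBound_holds : HeightOptimisedBound := by
  obtain ⟨A, hA⟩ := exists_abs_limKernel_le_height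
  exact ⟨1 / 2, A, by norm_num, fun θ hθ b hb x => hA θ (by linarith) b hb x⟩

/-- **`LinearCleanRadius` HOLDS** (RH-FREE): there are `c > 0` and `θ₁` with every window `0 ≤ t ≤ cθ` of `𝖪_θ`
free of the eigenvalues `±1`, for all `θ ≥ θ₁` — the θ-uniform, explicit-rate form of [Su20] Thm 1.2 (K-v). -/
theorem linearCleanRadius_holds : LinearCleanRadius :=
  exists_linear_clean_radius

/-- **`EventuallyCleanEachWindow` HOLDS** (RH-FREE): every fixed window radius `T ≥ 0` is clean for all large `θ`
(the quantifier swap of the residual `AllWindowsWitness`; says nothing about it). -/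
theorem eventuallyCleanEachWindow_holds : EventuallyCleanEachWindow :=
  eventuallyCleanEachWindow_of_linearCleanRadius linearCleanRadius_holds

end Summit.RiemannHypothesis.RiemannHypothesis.Theorems.SuzukiCleanRadius

end
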